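import Summits.NavierStokesRegularity.NavierStokesRegularity.Theses.CloudStretchingBudget
import Literature.Analysis.FluidPDE.TypeIAncientMild
import HarnessLib.Audit

/-!
# Birth skeleton (BC3) of the crux `CloudStretchingBudget.AdaptedVorticityFloor` — line `birth`

(crux item `stmt-NavierStokesRegularity-17840`, rank 3, joint J₁ of route
`route-NavierStokesRegularity-CloudStretchingBudget`; tree path
`Cruxes/AdaptedVorticityFloor/Lines/birth.lean`; registrar
`planner-skel-stmt-NavierStokesRegularity-17840-0`, 2026-08-17.)

THE CRUX (J₁). For a classical Leray–Hopf solution `u` on `[0, T)` from a rapidly decaying datum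
with the eventual Type-I RATE `√(T - t) ‖u t x‖ ≤ C √ν`, a point `x₀` carrying scale-invariant
`L³` concentration `∀ᶠ t < T, γ ν³ ≤ ∫_{B(x₀, ρ √(ν (T - t)))} ‖u t‖³` (the conclusion of the PROVED
`TypeICertificateLadder.TypeIConcentration`), and an adapted two-sided-Gaussian backward kernel
`G` at `x₀` on `[t₀, T)` (the clauses of the PROVED `AdaptedFrequency.AdaptedKernelExists`), the
adapted vorticity mass `M(t) = ∫ ‖curl u(t)‖ G(t)` has a FLOOR: `∃ m > 0, ∀ᶠ t < T, m ≤ (T - t) M(t)`.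

THE LINE (the route header's mechanism, typed): FLAT TANGENT OF VANISHING MASS → RIGIDITY OF AN
IRROTATIONAL SLICE → shrinking-ball arithmetic.

* `stub_flatTangentOfVanishingMass` (the zoom; size M–L; load-bearing). If the floor fails, i.e.
  `(T - t) M(t)` is frequently (as `t ↑ T`) below every `m > 0`, pick `t_k ↑ T` with
  `(T - t_k) M(t_k) → 0` and zoom parabolically at the pole `(T, x₀)` with `λ_k = √(ν (T - t_k))`
  (viscosity scaled out): `v_k(s, y) = (λ_k/ν) u(T + λ_k² s/ν, x₀ + λ_k y)`. Exactly:
  `∫ ‖curl v_k(-1, y)‖ G_k(-1, y) dy = (T - t_k) M(t_k)` with `G_k = λ_k³ G ∘ zoom` of unit mass,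
  and the Gaussian LOWER bound of `G` makes `G_k(-1, ·) ≥ c₁ ν^{3/2} e^{-ν ‖y‖²/c₂}` — a FIXED
  positive weight; the Type-I rate gives `‖v_k(s, y)‖ ≤ C/√(-s)` on windows `(A_k, 0)`,
  `A_k → -∞`; the zooms are classical, hence Oseen-mild between window times
  (tree: `Theorems.exists_zoom_blowupData`-type bookkeeping, `oseenMild_viscosity_of_typeI_window`).
  By the tree's `C²_loc` compactness of Type-I Oseen-mild fields on expanding windows
  (`Theorems.exists_tendsto_of_typeI_oseenMild_windows`, KNSS 2009 Lemma 6.1 / Prop. 4.1) a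
  subsequence converges slice-wise locally uniformly with gradients to `W ∈ IsTypeIAncientMild C`;
  Fatou with the fixed weight gives `curl W(-1, ·) ≡ 0`, and the concentration, which is
  scale-exact (`∫_{B(x₀, ρ λ_k √(-s))} ‖u‖³ = ν³ ∫_{B(0, ρ √(-s))} ‖v_k(s)‖³`), passes to the locally
  uniform limit: `γ ≤ ∫_{B(0, ρ √(-s))} ‖W(s)‖³` for `s ∈ [-1, 0)`. NO kernel compactness is
  needed (only the Gaussian lower bound at the single time `t_k`), which removes the risk named
  in the item's why-it-might-fail; what remains is the integrability of `‖ω(t_k)‖ G(t_k)`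
  (interior gradient bounds of bounded classical solutions, KNSS Prop. 4.1, tree
  `WindowRegularity`) so that the Bochner value `M(t_k)` is honest.
* `stub_rigidityOfIrrotationalSlice` (size S–M; provable from tree pieces). A Type-I ancient
  mild field `W` (KNSS gauge, `IsTypeIAncientMild C' W`) whose slice at `s = -1` is irrotational is
  spatially constant on `[-1, 0)`: `W(-1)` is `C^∞`, bounded by `C'`, divergence- and curl-free,
  hence constant `b` (tree `eq_of_curl_eq_zero_of_isDivFree_of_bounded`, KNSS Lemma 3.1); the
  constant field solves the Oseen equation from the datum `b` (`oseenDuhamel_eq_zero_of_const`,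
  `UnboundedOperators.heatExtension_const`) and bounded solutions of the Oseen integral equation
  are unique on every `[-1, -δ]` (tree `oseenMild_bounded_unique`, KNSS §3–§4), so `W ≡ b` there.
* `not_concentrated_of_const` (PROVED here): a spatially constant field cannot carry
  `γ ≤ ∫_{B(0, ρ √(-s))} ‖b‖³ = ‖b‖³ |B₁| ρ³ (-s)^{3/2}` for all `s ∈ [-1, 0)` with `γ > 0`
  (`s ↑ 0`).
* `AdaptedVorticityFloor_of_hyps` (the composition over the stub STATEMENTS, real proof, closed:
  axioms propext / Classical.choice / Quot.sound): by contradiction, the negated floor is exactly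
  the vanishing-mass hypothesis of stub 1; stubs 1, 2 and the arithmetic clash;
  `AdaptedVorticityFloor_of : AdaptedVorticityFloor` applies it to the two registered stubs BY NAME
  (the only other theorem of the file concluding the crux; closed modulo the two stub `sorry`s).

DISPROOF / NEGATIVES USED. No `Disproof.lean` exists for this crux (2026-08-17). The landed
negative lemma `Theorems.AdaptedVorticityFloorNegative.adaptedVorticityFloor_false_without_concentration`
(p143106: the crux minus the `L³`-concentration clause is FALSE, witness the rest state with the
backward heat kernel) is honoured: the concentration hypothesis is consumed by
`stub_flatTangentOfVanishingMass` (transferred to the tangent flow, third conjunct) and it is that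
conjunct which the composition plays against the constancy from stub 2 — for the rest state the
tangent is `W ≡ 0`, constant, and no contradiction arises without it. Neither stub is an instance
the negative lemma refutes (stub 1 keeps the concentration clause; stub 2 is about ancient fields).
-/

noncomputable section

open Set MeasureTheory Filter Topology Metric Function
open scoped ENNReal
open Literature.Analysis Literature.Analysis.FluidPDE

namespace Summit.NavierStokesRegularity.NavierStokesRegularity.Cruxes.AdaptedVorticityFloor.Birth

open Summit.NavierStokesRegularity.NavierStokesRegularity.Theses.CloudStretchingBudget

set_option linter.unusedVariables false
set_option linter.dupNamespace false

local notation "ℝ³" => EuclideanSpace ℝ (Fin 3)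

/-- **stub 1 — `stub_flatTangentOfVanishingMass` (the zoom; load-bearing, size M–L).**
Under the hypotheses of the crux verbatim (classical Leray–Hopf rapidly-decaying-datum solution
with eventual Type-I rate `C √ν`, `L³` concentration `(ρ, γ)` at `x₀`, adapted two-sided-Gaussian
kernel `G` at `x₀` on `[t₀, T)`), IF the adapted vorticity mass is frequently below every floor,
`∀ m > 0, ∃ᶠ t ↑ T, (T - t) ∫ ‖curl u(t)‖ G(t) < m`, THEN there is a FLAT TANGENT: a Type-I ancient
mild field `W` in the KNSS gauge (`IsTypeIAncientMild C' W`: jointly smooth on `(-∞,0) × ℝ³`,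
divergence free, Oseen-mild between all `s < t < 0`, `‖W(s, y)‖ ≤ C'/√(-s)`) whose slice at
`s = -1` is irrotational and which still carries the scale-invariant concentration
`γ ≤ ∫_{B(0, ρ √(-s))} ‖W(s)‖³` for `s ∈ [-1, 0)` (parabolic zoom at the pole with
`λ_k = √(ν (T - t_k))` along `(T - t_k) M(t_k) → 0`; `C²_loc` compactness
`Theorems.exists_tendsto_of_typeI_oseenMild_windows`; Fatou against the fixed Gaussian weight
`c₁ ν^{3/2} e^{-ν‖y‖²/c₂} ≤ G_k(-1, ·)`; locally uniform limit in the scale-exact concentration).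
[cite: KochNadirashviliSereginSverak2009, Lemma 6.1 and Prop. 4.1 (arXiv:0709.3599);
BarkerPrange2020 = arXiv:1812.09115, Thm 2; ConstantinIyer arXiv:math/0511067] [status: open] -/
theorem stub_flatTangentOfVanishingMass :
    ∀ C : ℝ, 0 < C → ∀ (ν T : ℝ), 0 < ν → 0 < T →
    ∀ (u : ℝ → ℝ³ → ℝ³) (p : ℝ → ℝ³ → ℝ),
    IsClassicalNSSolutionOn (Set.Ico 0 T) ν 0 u p →
    IsLerayHopfOn T ν 0 (u 0) u →
    HasRapidSpatialDecay (u 0) →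
    (∀ᶠ t in 𝓝[<] T, ∀ x, Real.sqrt (T - t) * ‖u t x‖ ≤ C * Real.sqrt ν) →
    ∀ (x₀ : ℝ³) (ρ γ : ℝ), 0 < ρ → 0 < γ →
    (∀ᶠ t in 𝓝[<] T, γ * ν ^ 3 ≤ ∫ x in Metric.ball x₀ (ρ * Real.sqrt (ν * (T - t))), ‖u t x‖ ^ 3) →
    ∀ (t₀ : ℝ) (G : ℝ → ℝ³ → ℝ), t₀ ∈ Set.Ico 0 T →
    (ContDiffOn ℝ 2 (Function.uncurry G) (Set.Ico t₀ T ×ˢ Set.univ) ∧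
      (∀ t ∈ Set.Ico t₀ T, ∀ x, 0 < G t x) ∧
      (∀ t ∈ Set.Ico t₀ T, ∀ x,
        timeDerivWithin (Set.Ico t₀ T) G t x + fderiv ℝ (G t) x (u t x) +
          ν * Laplacian.laplacian (G t) x = 0) ∧
      (∀ t ∈ Set.Ico t₀ T, ∫ x, G t x = 1) ∧
      (∀ φ : ℝ³ → ℝ, Continuous φ → (∃ M : ℝ, ∀ x, |φ x| ≤ M) →
        Filter.Tendsto (fun t => ∫ x, φ x * G t x) (nhdsWithin T (Set.Iio T)) (nhds (φ x₀)))) →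
    (∃ c₁ c₂ C₁ C₂ : ℝ, 0 < c₁ ∧ 0 < c₂ ∧ 0 < C₁ ∧ 0 < C₂ ∧ ∀ t ∈ Set.Ico t₀ T, ∀ x,
      c₁ * (T - t) ^ (-(3:ℝ) / 2) * Real.exp (-(‖x - x₀‖ ^ 2) / (c₂ * (T - t))) ≤ G t x ∧
        G t x ≤ C₁ * (T - t) ^ (-(3:ℝ) / 2) * Real.exp (-(‖x - x₀‖ ^ 2) / (C₂ * (T - t)))) →
    (∀ m : ℝ, 0 < m → ∃ᶠ t in 𝓝[<] T, (T - t) * ∫ x, ‖curl (u t) x‖ * G t x < m) →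
    ∃ (C' : ℝ) (W : ℝ → ℝ³ → ℝ³), IsTypeIAncientMild C' W ∧
      (∀ y, curl (W (-1)) y = 0) ∧
      (∀ s ∈ Set.Ico (-1 : ℝ) 0,
        γ ≤ ∫ y in Metric.ball (0 : ℝ³) (ρ * Real.sqrt (-s)), ‖W s y‖ ^ 3) := by
  sorry

/-- **stub 2 — `stub_rigidityOfIrrotationalSlice` (size S–M; all ingredients in the tree).**
A Type-I ancient mild field in the KNSS gauge whose slice at `s = -1` is irrotational is spatially
constant on `[-1, 0)`: Liouville for bounded `C²` fields with `curl = 0`, `div = 0`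
(`eq_of_curl_eq_zero_of_isDivFree_of_bounded`) makes `W(-1) ≡ b`; the constant field solves the
Oseen equation from `b` (`oseenDuhamel_eq_zero_of_const`, `UnboundedOperators.heatExtension_const`),
and bounded solutions of the Oseen integral equation with the same free term agree
(`oseenMild_bounded_unique`) on every `[-1, -δ]`, `δ > 0`.
[cite: KochNadirashviliSereginSverak2009, Lemma 3.1, §3 p. 6, §4 (4.3)–(4.4) (arXiv:0709.3599)]
[status: open] -/
theorem stub_rigidityOfIrrotationalSlice :
    ∀ (C' : ℝ) (W : ℝ → ℝ³ → ℝ³), IsTypeIAncientMild C' W → (∀ y, curl (W (-1)) y = 0) →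
      ∃ b : ℝ³, ∀ s ∈ Set.Ico (-1 : ℝ) 0, ∀ y, W s y = b := by
  sorry

/-- **Shrinking-ball arithmetic (proved).** A field which is the constant `b` on `[-1, 0) × ℝ³`
cannot carry the scale-invariant concentration `γ ≤ ∫_{B(0, ρ √(-s))} ‖W(s)‖³` for all
`s ∈ [-1, 0)` with `γ > 0`: the right-hand side is `‖b‖³ |B₁| (ρ √(-s))³ → 0` as `s ↑ 0`. [folklore] -/
theorem not_concentrated_of_const {ρ γ : ℝ} (hρ : 0 < ρ) (hγ : 0 < γ) {W : ℝ → ℝ³ → ℝ³} {b : ℝ³}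
    (hb : ∀ s ∈ Set.Ico (-1 : ℝ) 0, ∀ y, W s y = b)
    (hconc : ∀ s ∈ Set.Ico (-1 : ℝ) 0,
      γ ≤ ∫ y in Metric.ball (0 : ℝ³) (ρ * Real.sqrt (-s)), ‖W s y‖ ^ 3) : False := by
  set V₁ : ℝ := (volume (Metric.ball (0 : ℝ³) 1)).toReal with hV₁
  -- the concentration integral of the constant field, in closed form
  have hint : ∀ s ∈ Set.Ico (-1 : ℝ) 0,
      ∫ y in Metric.ball (0 : ℝ³) (ρ * Real.sqrt (-s)), ‖W s y‖ ^ 3 =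
        (ρ * Real.sqrt (-s)) ^ 3 * V₁ * ‖b‖ ^ 3 := by
    intro s hs
    have hr : 0 < ρ * Real.sqrt (-s) := mul_pos hρ (Real.sqrt_pos.2 (by linarith [hs.2]))
    have hvol : (volume (Metric.ball (0 : ℝ³) (ρ * Real.sqrt (-s)))).toReal =
        (ρ * Real.sqrt (-s)) ^ 3 * V₁ := by
      rw [Measure.addHaar_ball_of_pos volume (0 : ℝ³) hr, ENNReal.toReal_mul,
        finrank_euclideanSpace_fin, ENNReal.toReal_ofReal (pow_nonneg hr.le _)]
    rw [setIntegral_congr_fun measurableSet_ball (fun y _ => by rw [hb s hs y]),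
      setIntegral_const, smul_eq_mul, measureReal_def, hvol]
  -- it tends to `0` as `s ↑ 0`
  have hcont : Continuous fun s : ℝ => (ρ * Real.sqrt (-s)) ^ 3 * V₁ * ‖b‖ ^ 3 :=
    ((continuous_const.mul (Real.continuous_sqrt.comp continuous_neg)).pow 3).mul
      continuous_const |>.mul continuous_const
  have hlim : Tendsto (fun s : ℝ => (ρ * Real.sqrt (-s)) ^ 3 * V₁ * ‖b‖ ^ 3) (𝓝[<] (0 : ℝ))
      (𝓝 0) := by
    have h := hcont.tendsto 0
    simp only [neg_zero, Real.sqrt_zero, mul_zero, ne_eq, OfNat.ofNat_ne_zero,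
      not_false_eq_true, zero_pow, zero_mul] at h
    exact h.mono_left nhdsWithin_le_nhds
  -- while it stays above `γ > 0` on `[-1, 0)`
  have hev : ∀ᶠ s in 𝓝[<] (0 : ℝ), γ ≤ (ρ * Real.sqrt (-s)) ^ 3 * V₁ * ‖b‖ ^ 3 := by
    filter_upwards [Ico_mem_nhdsLT (show (-1 : ℝ) < 0 by norm_num)] with s hs
    rw [← hint s hs]
    exact hconc s hs
  have hγ0 : γ ≤ 0 := ge_of_tendsto hlim hev
  linarith

/-- **Composition, closed form (real proof, no `sorry`, no stub constant used): the two stub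
STATEMENTS imply the crux (stated through its definiens; `AdaptedVorticityFloor_of` restates it by
name).** By contradiction: the negated floor says that `(T - t) M(t)`
is frequently below every `m > 0`, which is the vanishing-mass hypothesis of
`stub_flatTangentOfVanishingMass`; the flat tangent it yields is spatially constant on `[-1, 0)` by
`stub_rigidityOfIrrotationalSlice`, and a constant cannot carry the transferred `L³` concentration
(`not_concentrated_of_const`). Axioms: propext, Classical.choice, Quot.sound. -/
theorem AdaptedVorticityFloor_of_hyps :
    (∀ C : ℝ, 0 < C → ∀ (ν T : ℝ), 0 < ν → 0 < T →
    ∀ (u : ℝ → ℝ³ → ℝ³) (p : ℝ → ℝ³ → ℝ),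
    IsClassicalNSSolutionOn (Set.Ico 0 T) ν 0 u p →
    IsLerayHopfOn T ν 0 (u 0) u →
    HasRapidSpatialDecay (u 0) →
    (∀ᶠ t in 𝓝[<] T, ∀ x, Real.sqrt (T - t) * ‖u t x‖ ≤ C * Real.sqrt ν) →
    ∀ (x₀ : ℝ³) (ρ γ : ℝ), 0 < ρ → 0 < γ →
    (∀ᶠ t in 𝓝[<] T, γ * ν ^ 3 ≤ ∫ x in Metric.ball x₀ (ρ * Real.sqrt (ν * (T - t))), ‖u t x‖ ^ 3) →
    ∀ (t₀ : ℝ) (G : ℝ → ℝ³ → ℝ), t₀ ∈ Set.Ico 0 T →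
    (ContDiffOn ℝ 2 (Function.uncurry G) (Set.Ico t₀ T ×ˢ Set.univ) ∧
      (∀ t ∈ Set.Ico t₀ T, ∀ x, 0 < G t x) ∧
      (∀ t ∈ Set.Ico t₀ T, ∀ x,
        timeDerivWithin (Set.Ico t₀ T) G t x + fderiv ℝ (G t) x (u t x) +
          ν * Laplacian.laplacian (G t) x = 0) ∧
      (∀ t ∈ Set.Ico t₀ T, ∫ x, G t x = 1) ∧
      (∀ φ : ℝ³ → ℝ, Continuous φ → (∃ M : ℝ, ∀ x, |φ x| ≤ M) →
        Filter.Tendsto (fun t => ∫ x, φ x * G t x) (nhdsWithin T (Set.Iio T)) (nhds (φ x₀)))) →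
    (∃ c₁ c₂ C₁ C₂ : ℝ, 0 < c₁ ∧ 0 < c₂ ∧ 0 < C₁ ∧ 0 < C₂ ∧ ∀ t ∈ Set.Ico t₀ T, ∀ x,
      c₁ * (T - t) ^ (-(3:ℝ) / 2) * Real.exp (-(‖x - x₀‖ ^ 2) / (c₂ * (T - t))) ≤ G t x ∧
        G t x ≤ C₁ * (T - t) ^ (-(3:ℝ) / 2) * Real.exp (-(‖x - x₀‖ ^ 2) / (C₂ * (T - t)))) →
    (∀ m : ℝ, 0 < m → ∃ᶠ t in 𝓝[<] T, (T - t) * ∫ x, ‖curl (u t) x‖ * G t x < m) →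
    ∃ (C' : ℝ) (W : ℝ → ℝ³ → ℝ³), IsTypeIAncientMild C' W ∧
      (∀ y, curl (W (-1)) y = 0) ∧
      (∀ s ∈ Set.Ico (-1 : ℝ) 0,
        γ ≤ ∫ y in Metric.ball (0 : ℝ³) (ρ * Real.sqrt (-s)), ‖W s y‖ ^ 3)) →
    (∀ (C' : ℝ) (W : ℝ → ℝ³ → ℝ³), IsTypeIAncientMild C' W → (∀ y, curl (W (-1)) y = 0) →
      ∃ b : ℝ³, ∀ s ∈ Set.Ico (-1 : ℝ) 0, ∀ y, W s y = b) →
    -- the crux `AdaptedVorticityFloor`, stated through its definiens (verbatim signature of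
    -- item stmt-NavierStokesRegularity-17840), so that `AdaptedVorticityFloor_of` below is the
    -- only theorem of this file concluding the crux BY NAME
    ∀ C : ℝ, 0 < C → ∀ (ν T : ℝ), 0 < ν → 0 < T →
    ∀ (u : ℝ → ℝ³ → ℝ³) (p : ℝ → ℝ³ → ℝ),
    IsClassicalNSSolutionOn (Set.Ico 0 T) ν 0 u p →
    IsLerayHopfOn T ν 0 (u 0) u →
    HasRapidSpatialDecay (u 0) →
    (∀ᶠ t in 𝓝[<] T, ∀ x, Real.sqrt (T - t) * ‖u t x‖ ≤ C * Real.sqrt ν) →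
    ∀ (x₀ : ℝ³) (ρ γ : ℝ), 0 < ρ → 0 < γ →
    (∀ᶠ t in 𝓝[<] T, γ * ν ^ 3 ≤ ∫ x in Metric.ball x₀ (ρ * Real.sqrt (ν * (T - t))), ‖u t x‖ ^ 3) →
    ∀ (t₀ : ℝ) (G : ℝ → ℝ³ → ℝ), t₀ ∈ Set.Ico 0 T →
    (ContDiffOn ℝ 2 (Function.uncurry G) (Set.Ico t₀ T ×ˢ Set.univ) ∧
      (∀ t ∈ Set.Ico t₀ T, ∀ x, 0 < G t x) ∧
      (∀ t ∈ Set.Ico t₀ T, ∀ x,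
        timeDerivWithin (Set.Ico t₀ T) G t x + fderiv ℝ (G t) x (u t x) +
          ν * Laplacian.laplacian (G t) x = 0) ∧
      (∀ t ∈ Set.Ico t₀ T, ∫ x, G t x = 1) ∧
      (∀ φ : ℝ³ → ℝ, Continuous φ → (∃ M : ℝ, ∀ x, |φ x| ≤ M) →
        Filter.Tendsto (fun t => ∫ x, φ x * G t x) (nhdsWithin T (Set.Iio T)) (nhds (φ x₀)))) →
    (∃ c₁ c₂ C₁ C₂ : ℝ, 0 < c₁ ∧ 0 < c₂ ∧ 0 < C₁ ∧ 0 < C₂ ∧ ∀ t ∈ Set.Ico t₀ T, ∀ x,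
      c₁ * (T - t) ^ (-(3:ℝ) / 2) * Real.exp (-(‖x - x₀‖ ^ 2) / (c₂ * (T - t))) ≤ G t x ∧
        G t x ≤ C₁ * (T - t) ^ (-(3:ℝ) / 2) * Real.exp (-(‖x - x₀‖ ^ 2) / (C₂ * (T - t)))) →
    ∃ m : ℝ, 0 < m ∧ ∀ᶠ t in 𝓝[<] T, m ≤ (T - t) * ∫ x, ‖curl (u t) x‖ * G t x := by
  intro h1 h2
  intro C hC ν T hν hT u p hcl hLH hdec hrate x₀ ρ γ hρ hγ hconc t₀ G ht₀ hK hGb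
  by_contra hno
  -- the negated floor: the adapted vorticity mass is frequently below every `m > 0`
  have hfreq : ∀ m : ℝ, 0 < m →
      ∃ᶠ t in 𝓝[<] T, (T - t) * ∫ x, ‖curl (u t) x‖ * G t x < m := by
    intro m hm
    by_contra hnot
    exact hno ⟨m, hm, (Filter.not_frequently.1 hnot).mono fun t ht => not_lt.1 ht⟩
  -- stub 1: the flat tangent; stub 2: it is constant; arithmetic: contradiction
  obtain ⟨C', W, hW, hcurl, hWconc⟩ :=
    h1 C hC ν T hν hT u p hcl hLH hdec hrate x₀ ρ γ hρ hγ hconc t₀ G ht₀ hK hGb hfreq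
  obtain ⟨b, hb⟩ := h2 C' W hW hcurl
  exact not_concentrated_of_const hρ hγ hb hWconc

/-- **Birth composition (the skeleton theorem, A12 shape): the crux BY NAME from the two
registered stubs, used by name; all glue is in the closed `AdaptedVorticityFloor_of_hyps`.**
(Closed modulo the `sorry`s of `stub_flatTangentOfVanishingMass` and
`stub_rigidityOfIrrotationalSlice` only.) -/
theorem AdaptedVorticityFloor_of : AdaptedVorticityFloor :=
  AdaptedVorticityFloor_of_hyps stub_flatTangentOfVanishingMass stub_rigidityOfIrrotationalSlice

end Summit.NavierStokesRegularity.NavierStokesRegularity.Cruxes.AdaptedVorticityFloor.Birth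

end
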